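import Summits.ValiantsHypothesis.ValiantsHypothesis.Theorems.KPlusLogSqLawValuativeDoorNestedPairs

/-!
# LINE `valuative_door` (crux `WeakLifting`, stmt-ValiantsHypothesis-19561) — the `m = 2` SIDON LAW, ALL `K`:
# a symmetric `2 × 2` lacunary pencil with `K` letters on a Sidon support has `npEdges ≤ 3K − 4`

HONEST FRAMING.  Helper (cell `pub-symmetroid`, seat val-sym-lift-p1 g23, 2026-08-29; `--supports 19561 --as helper`).  The g22 CLOSING
block's located leftover «the m = 2 Sidon law» — in a LINEAR form.  For every `K`, every field of characteristic zero with a non-archimedean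
absolute value, every exponent vector `d : Fin K → ℕ` with pairwise distinct pair sums (SIDON support) and every `K` symmetric `2 × 2` letters,
`det (Σ_l X^{d_l} S_l)` has at most `3K − 3` dominant exponents, i.e. `npEdges ≤ 3K − 4` (`valSidonTwo_unfolded`; `K = 2, 3`: the trivial
`2, 5`; `K = 4`: the `8` of `…TwoFourCalibration` = v(2,4), so sharp there; the constant `3K − 4` is the cell's tropical patchwork ceiling at
`m = 2`).  Proof: sort the letters; by `…NestedPairs.not_nested_dominant_of_sidon` the dominant OFF-DIAGONAL pairs `(i < j)` contain no two
nested ones, i.e. they form a chain for the product order (`i < i' ⇒ j ≤ j'`), so `(i, j) ↦ i + j` is injective on them with values in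
`[1, 2K − 3]` (`card_le_of_pairChain`, stated with a gap parameter `g` for the general-pencil sequel): at most `2K − 3` off-diagonal plus `K` diagonal dominant exponents.  Off Sidon supports (coinciding pair
sums, first case `K = 5`) in-class cancellation enters and nothing is claimed; sharpness beyond `K = 4` is not claimed.  Calibration only
(`m = 2`); no bearing on vW / vB, `TropicalB`, `MatrixDescartes` (18050) or VP ≠ VNP.  [elementary]
-/

set_option linter.dupNamespace false
set_option autoImplicit false

namespace Summit.ValiantsHypothesis.ValiantsHypothesis.Theorems.KPlusLogSqLaw.ValDoor

open Polynomial Finset Matrix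
open scoped BigOperators Classical

variable {F : Type*} [Field F]

/-! ## §1 Chains of pairs -/

/-- **a chain of pairs `i + g < j` in `Fin K` (for the product order) has at most `2K − 3 − 2g` members:** `(i, j) ↦ i + j` is
injective on it with values in `[g + 1, 2K − 3 − g]` (`g = 0`: plain pairs `i < j`, at most `2K − 3`). [elementary] -/
theorem card_le_of_pairChain {K : ℕ} (g : ℕ) (D : Finset (Fin K × Fin K)) (hlt : ∀ p ∈ D, p.1.val + g < p.2.val)
    (hchain : ∀ p ∈ D, ∀ p' ∈ D, p.1 < p'.1 → p.2 ≤ p'.2) : D.card ≤ 2 * K - 3 - 2 * g := by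
  have hinj : Set.InjOn (fun p : Fin K × Fin K => p.1.val + p.2.val) (D : Set (Fin K × Fin K)) := by
    intro p hp p' hp' heq
    simp only [] at heq
    rcases lt_trichotomy p.1 p'.1 with h | h | h
    · have h2 : p.2 ≤ p'.2 := hchain p hp p' hp' h
      have h1 : p.1.val < p'.1.val := h
      have h2' : p.2.val ≤ p'.2.val := h2
      omega
    · have h2 : p.2.val = p'.2.val := by have := congrArg Fin.val h; omega
      exact Prod.ext h (Fin.ext h2)
    · have h2 : p'.2 ≤ p.2 := hchain p' hp' p hp h
      have h1 : p'.1.val < p.1.val := h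
      have h2' : p'.2.val ≤ p.2.val := h2
      omega
  have hsub : D.image (fun p : Fin K × Fin K => p.1.val + p.2.val) ⊆ Finset.Icc (g + 1) (2 * K - 3 - g) := by
    intro s hs
    obtain ⟨p, hp, rfl⟩ := Finset.mem_image.1 hs
    have h1 : p.1.val + g < p.2.val := hlt p hp
    have h2 : p.2.val < K := p.2.isLt
    rw [Finset.mem_Icc]
    omega
  calc D.card = (D.image fun p : Fin K × Fin K => p.1.val + p.2.val).card := (Finset.card_image_of_injOn hinj).symm
    _ ≤ (Finset.Icc (g + 1) (2 * K - 3 - g)).card := Finset.card_le_card hsub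
    _ ≤ 2 * K - 3 - 2 * g := by rw [Nat.card_Icc]; omega

/-! ## §2 The `m = 2` Sidon law for sorted letters -/

/-- **at most `(2K − 3) + K` dominant exponents** for a symmetric `2 × 2` Sidon pencil with strictly increasing exponents: the dominant
off-diagonal pairs form a chain (no two nested, `not_nested_dominant_of_sidon`), the diagonal contributes at most `K`. [assembly] -/
theorem domCount_le_of_sidon_sorted (v : AbsoluteValue F ℝ) (hv : IsNonarchimedean v) {K : ℕ} (d : Fin K → ℕ) (hd : StrictMono d)
    (S : Fin K → Matrix (Fin 2) (Fin 2) F) (hS : ∀ l, (S l).IsSymm)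
    (hsid : ∀ l₁ l₂ l₃ l₄ : Fin K, d l₁ + d l₂ = d l₃ + d l₄ → (l₁ = l₃ ∧ l₂ = l₄) ∨ (l₁ = l₄ ∧ l₂ = l₃)) :
    ((Matrix.det (∑ l, ((X : F[X]) ^ d l) • (S l).map (C : F →+* F[X]))).support.filter fun E =>
        ∃ r : ℝ, 0 < r ∧ ∀ E' ∈ (Matrix.det (∑ l, ((X : F[X]) ^ d l) • (S l).map (C : F →+* F[X]))).support, E' ≠ E →
          v ((Matrix.det (∑ l, ((X : F[X]) ^ d l) • (S l).map (C : F →+* F[X]))).coeff E') * r ^ E'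
            < v ((Matrix.det (∑ l, ((X : F[X]) ^ d l) • (S l).map (C : F →+* F[X]))).coeff E) * r ^ E).card
      ≤ (2 * K - 3) + K := by
  set f : F[X] := Matrix.det (∑ l, ((X : F[X]) ^ d l) • (S l).map (C : F →+* F[X])) with hf
  set D := f.support.filter fun E => ∃ r : ℝ, 0 < r ∧ ∀ E' ∈ f.support, E' ≠ E →
      v (f.coeff E') * r ^ E' < v (f.coeff E) * r ^ E with hD
  -- off-diagonal dominant pairs and the diagonal
  set Doff : Finset (Fin K × Fin K) := (univ : Finset (Fin K × Fin K)).filter fun p => p.1 < p.2 ∧ d p.1 + d p.2 ∈ D with hDoff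
  set Diag : Finset ℕ := (univ : Finset (Fin K)).image fun i => d i + d i with hDiag
  have hcover : D ⊆ Doff.image (fun p => d p.1 + d p.2) ∪ Diag := by
    intro E hE
    have hEsupp : E ∈ f.support := (Finset.mem_filter.1 hE).1
    have hne := Polynomial.mem_support_iff.1 hEsupp
    rw [hf, coeff_det_symmPencil_two d S hS E] at hne
    obtain ⟨p, hp, -⟩ := Finset.exists_ne_zero_of_sum_ne_zero hne
    obtain ⟨-, hpE⟩ := Finset.mem_filter.1 hp
    rw [Finset.mem_union]
    rcases lt_trichotomy p.1 p.2 with h | h | h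
    · left
      refine Finset.mem_image.2 ⟨(p.1, p.2), Finset.mem_filter.2 ⟨Finset.mem_univ _, h, ?_⟩, hpE⟩
      rw [hpE]; exact hE
    · right
      exact Finset.mem_image.2 ⟨p.1, Finset.mem_univ _, by rw [← hpE, h]⟩
    · left
      refine Finset.mem_image.2 ⟨(p.2, p.1), Finset.mem_filter.2 ⟨Finset.mem_univ _, h, ?_⟩, by rw [← hpE, Nat.add_comm]⟩
      show d p.2 + d p.1 ∈ D
      rw [Nat.add_comm, hpE]; exact hE
  -- the off-diagonal dominant pairs form a chain
  have hchain : ∀ p ∈ Doff, ∀ p' ∈ Doff, p.1 < p'.1 → p.2 ≤ p'.2 := by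
    intro p hp p' hp' h1
    obtain ⟨-, hp12, hpD⟩ := Finset.mem_filter.1 hp
    obtain ⟨-, hp12', hpD'⟩ := Finset.mem_filter.1 hp'
    by_contra h2
    push Not at h2
    -- nested: p.1 < p'.1 < p'.2 < p.2
    exact not_nested_dominant_of_sidon v hv d S hS hsid (hd h1) (hd hp12') (hd h2)
      (Finset.mem_filter.1 hpD) (Finset.mem_filter.1 hpD')
  have hoff : Doff.card ≤ 2 * K - 3 := by
    have h := card_le_of_pairChain 0 Doff (fun p hp => by simpa using (Finset.mem_filter.1 hp).2.1) hchain
    simpa using h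
  have hdiag : Diag.card ≤ K := Finset.card_image_le.trans (by rw [Finset.card_univ, Fintype.card_fin])
  calc D.card ≤ (Doff.image (fun p => d p.1 + d p.2) ∪ Diag).card := Finset.card_le_card hcover
    _ ≤ (Doff.image fun p => d p.1 + d p.2).card + Diag.card := Finset.card_union_le _ _
    _ ≤ Doff.card + K := Nat.add_le_add (Finset.card_image_le) hdiag
    _ ≤ (2 * K - 3) + K := Nat.add_le_add_right hoff K

/-! ## §3 The `m = 2` Sidon law, unfolded -/

/-- **THE `m = 2` SIDON LAW (all `K`), UNFOLDED:** over a field of characteristic zero with a non-archimedean absolute value, every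
symmetric `2 × 2` lacunary pencil `Σ_l X^{d_l} S_l` with `K` letters on a SIDON support (pairwise distinct pair sums `d_l + d_{l'}`, `l ≤ l'`)
has `npEdges ≤ 3K − 4`: at most `3K − 3` of its at most `K(K+1)/2` support exponents are dominant (`K = 4`: the `8` of
`valTwoFourCalibration_unfolded`; the binders are those of `ValRootLawAt 2 K (3 * K - 4)` plus the Sidon hypothesis).
[nested-pair exclusion + chain count] -/
theorem valSidonTwo_unfolded :
    ∀ (F : Type) [Field F] [CharZero F] (v : AbsoluteValue F ℝ), IsNonarchimedean v →
      ∀ (K : ℕ) (d : Fin K → ℕ) (S : Fin K → Matrix (Fin 2) (Fin 2) F), (∀ l, (S l).IsSymm) →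
        (∀ l₁ l₂ l₃ l₄ : Fin K, d l₁ + d l₂ = d l₃ + d l₄ → (l₁ = l₃ ∧ l₂ = l₄) ∨ (l₁ = l₄ ∧ l₂ = l₃)) →
        ((Matrix.det (∑ l, ((Polynomial.X : Polynomial F) ^ d l) • (S l).map Polynomial.C)).support.filter fun E =>
            ∃ r : ℝ, 0 < r ∧ ∀ E' ∈ (Matrix.det (∑ l, ((Polynomial.X : Polynomial F) ^ d l) • (S l).map Polynomial.C)).support,
              E' ≠ E →
              v ((Matrix.det (∑ l, ((Polynomial.X : Polynomial F) ^ d l) • (S l).map Polynomial.C)).coeff E') * r ^ E'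
                < v ((Matrix.det (∑ l, ((Polynomial.X : Polynomial F) ^ d l) • (S l).map Polynomial.C)).coeff E) * r ^ E).card - 1
          ≤ 3 * K - 4 := by
  intro F _ _ v hv K d S hS hsid
  -- Sidon ⇒ injective exponents; sort the letters
  have hdinj : Function.Injective d := by
    intro i j hij
    rcases hsid i i i j (by rw [hij]) with ⟨-, h⟩ | ⟨h, -⟩
    · exact h
    · exact h
  set σ : Equiv.Perm (Fin K) := Tuple.sort d with hσ
  have hmono : StrictMono (d ∘ σ) := (Tuple.monotone_sort d).strictMono_of_injective (hdinj.comp σ.injective)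
  have hS' : ∀ l, (S (σ l)).IsSymm := fun l => hS (σ l)
  have hsid' : ∀ l₁ l₂ l₃ l₄ : Fin K, (d ∘ σ) l₁ + (d ∘ σ) l₂ = (d ∘ σ) l₃ + (d ∘ σ) l₄ →
      (l₁ = l₃ ∧ l₂ = l₄) ∨ (l₁ = l₄ ∧ l₂ = l₃) := by
    intro l₁ l₂ l₃ l₄ h
    rcases hsid _ _ _ _ h with ⟨h1, h2⟩ | ⟨h1, h2⟩
    · exact Or.inl ⟨σ.injective h1, σ.injective h2⟩
    · exact Or.inr ⟨σ.injective h1, σ.injective h2⟩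
  have hf' : Matrix.det (∑ l, ((X : F[X]) ^ (d ∘ σ) l) • (S (σ l)).map (C : F →+* F[X]))
      = Matrix.det (∑ l, ((X : F[X]) ^ d l) • (S l).map (C : F →+* F[X])) :=
    congrArg Matrix.det (Equiv.sum_comp σ (fun l => ((X : F[X]) ^ d l) • (S l).map (C : F →+* F[X])))
  have h := domCount_le_of_sidon_sorted v hv (d ∘ σ) hmono (fun l => S (σ l)) hS' hsid'
  rw [hf'] at h
  omega

end Summit.ValiantsHypothesis.ValiantsHypothesis.Theorems.KPlusLogSqLaw.ValDoor
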